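import Summits.ResolutionOfSingularities.ResolutionOfSingularities.Theorems.PurelyInseparableDim4WildConesRun
import Summits.ResolutionOfSingularities.ResolutionOfSingularities.Theorems.PurelyInseparableDim4IsolatedChainBaseChange
import Summits.ResolutionOfSingularities.ResolutionOfSingularities.Theorems.PurelyInseparableDim4MilnorIsolated
import HarnessLib

/-!
# [OURS · res-dim4-pi «F4-I(3,3) BEYOND MILNOR-FINITE», brick (i)] The reduction: an infinite isolated
  point-blow-up chain must contain COFINALLY MANY Milnor-infinite states

Cell `res-dim4-pi` (D-0157 DOOR 2), desk WORD #35 (b) (seat `res-dim4-p-5` keyed): p-12's odd-`p` bridge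
`WildConesBridge.noMilnorFiniteStep0Chain` (`…WildConesRun`, p653895; the in-house route WildCones' target
`IsolatedForcedTermination`, stmt-16343) excludes infinite `Step0 p` chains all of whose states (from index 1) have
FINITE formal Milnor algebra `K⟦x⟧ ⧸ ⟨∂ᵢ↑F⟩`.  At `q = p ≥ 3` the frame's isolation `IsIsolated p F` (the
`p`-fold locus `V(J_p⁺(F))`, ALL Hasse derivatives of order `< p`) is WEAKER than Milnor-finiteness
(`IsolatedBand.isIsolated_of_milnorFinite`, p653434, gives only Milnor-finite ⇒ isolated).  DEF-FREE file;
«Milnor-finite» is written out as `Module.Finite K (K⟦x⟧ ⧸ ⟨∂ᵢ↑F⟩)`.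

## What is proved
* §1 `step0_chain_tail`, `isolated_chain_tail` — tails of chains are chains.
* §2 **`exists_ge_not_milnorFinite`** — over a PERFECT field of characteristic `p` (prime), along EVERY
  infinite `Step0 p` chain and beyond every index there is a state whose formal Milnor algebra is INFINITE
  (else a Milnor-finite tail contradicts `noMilnorFiniteStep0Chain`).  No isolation hypothesis is needed.
  This is the dichotomy that CAN be proved: Milnor-(in)finiteness is NOT inherited along the branch the
  chain chooses (a Milnor-infinite parent lifts its gradient curve only to its own tangent direction), so
  «all states Milnor-infinite» would be the wrong hypothesis shape.
* §3 **`noIsolatedTrap_iff_no_cofinal_milnorInfinite`** — for every prime `p`: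
  `NoIsolatedTrap p p ↔` no PERFECT field of characteristic `p` carries an infinite ISOLATED `Step0 p` chain
  with Milnor-INFINITE states beyond every index (p-14's `IsolatedChainBaseChange` supplies the passage to
  perfect fields); the `p = 3` instance **`noIsolatedTrap_three_three_of`** is the desk's reduction
  «F4-I(3,3) ⟸ no trap whose states are J₃⁺-isolated with cofinally many Milnor-infinite ones».
* §4 **`milnorFinite_iff_exists_gradient_certificate`** — the census face of «Milnor-finite»:
  `K⟦x⟧ ⧸ ⟨∂ᵢ↑F⟩` finite ⟺ `∃ N, 𝔪₀ᴺ ≤ ⟨∂ᵢF⟩ + 𝔪₀ᴺ⁺¹` in `K[x]` (p-12's Nakayama push + my truncation pull;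
  `⟨∂ᵢF⟩ = J₂⁺(F)` is char-free bookkeeping, p-3), so an engine decides Milnor-(in)finiteness of a state by the
  SAME stabilisation instrument PR-10 uses for isolation, run on the GRADIENT ideal.

[OURS · counted 0 · AI work weaker than expert review] Nothing here proves `NoIsolatedTrap 3 3` or resolution of
singularities in dimension ≥ 4 / characteristic `p`; a reduction inside OUR frame.
bears_on: LADDER-RESOLUTION:D157-DOOR2 (res-dim4-pi · F4-I(3,3) beyond Milnor-finite). Supports
stmt-ResolutionOfSingularities-16155 (helper).
-/

set_option linter.dupNamespace false -- mandated namespace of this single-conjunct summit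

noncomputable section

namespace Summit.ResolutionOfSingularities.ResolutionOfSingularities.Theorems.PIDim4

namespace IsolatedBand

open MvPolynomial Finset IsLocalRing
open Literature.AlgebraicGeometry.Resolution

variable {K : Type} [Field K]

/-! ## §1 Tails -/

/-- A tail of a `Step0` chain is a `Step0` chain. [folklore] -/
theorem step0_chain_tail [DecidableEq K] {q : ℕ} {c : ℕ → State K}
    (hc : ∀ k, Step0 q (c k) (c (k + 1))) (k₀ : ℕ) :
    ∀ k, Step0 q (c (k₀ + k)) (c (k₀ + k + 1)) :=
  fun k => hc (k₀ + k)

/-- A tail of an isolated `Step0` chain is an isolated `Step0` chain. [folklore] -/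
theorem isolated_chain_tail [DecidableEq K] {q : ℕ} {c : ℕ → State K}
    (hc : ∀ k, IsIsolated q (c k).F ∧ Step0 q (c k) (c (k + 1))) (k₀ : ℕ) :
    ∀ k, IsIsolated q (c (k₀ + k)).F ∧ Step0 q (c (k₀ + k)) (c (k₀ + k + 1)) :=
  fun k => hc (k₀ + k)

/-! ## §2 Cofinally many Milnor-infinite states -/

/-- **Along every infinite `Step0 p` chain over a PERFECT field of characteristic `p`, Milnor-INFINITE states
occur beyond every index** (a Milnor-finite tail is an all-Milnor-finite chain from its index 1, excluded by
p-12's `noMilnorFiniteStep0Chain`). No isolation hypothesis. [folklore] -/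
theorem exists_ge_not_milnorFinite (p : ℕ) (hp : p.Prime) (K : Type) [Field K] [CharP K p]
    [PerfectField K] [DecidableEq K] {c : ℕ → State K} (hc : ∀ k, Step0 p (c k) (c (k + 1)))
    (k₀ : ℕ) :
    ∃ k, k₀ ≤ k ∧ ¬ Module.Finite K (MvPowerSeries (Fin 4) K ⧸ Ideal.span (Set.range fun t : Fin 4 =>
      MvPowerSeries.pderiv t (((c k).F : MvPolynomial (Fin 4) K) : MvPowerSeries (Fin 4) K))) := by
  by_contra hno
  push Not at hno
  refine WildConesBridge.noMilnorFiniteStep0Chain p hp K ⟨fun k => c (k₀ + k), fun k => ⟨?_, ?_⟩⟩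
  · exact hc (k₀ + k)
  · have := hno (k₀ + (k + 1)) (Nat.le_add_right _ _)
    simpa only [Nat.add_assoc] using this

/-- Hence an infinite ISOLATED `Step0 p` chain over a perfect field contains a state that is `J_p⁺`-isolated
but Milnor-INFINITE — the sub-regime the in-house route does not cover (`p ≥ 3`; at `p = 2` there is none,
`isIsolated_two_iff_milnorFinite`). [folklore] -/
theorem exists_isolated_not_milnorFinite (p : ℕ) (hp : p.Prime) (K : Type) [Field K] [CharP K p]
    [PerfectField K] [DecidableEq K] {c : ℕ → State K}
    (hc : ∀ k, IsIsolated p (c k).F ∧ Step0 p (c k) (c (k + 1))) (k₀ : ℕ) :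
    ∃ k, k₀ ≤ k ∧ IsIsolated p (c k).F ∧
      ¬ Module.Finite K (MvPowerSeries (Fin 4) K ⧸ Ideal.span (Set.range fun t : Fin 4 =>
        MvPowerSeries.pderiv t (((c k).F : MvPolynomial (Fin 4) K) : MvPowerSeries (Fin 4) K))) := by
  obtain ⟨k, hk, hMI⟩ := exists_ge_not_milnorFinite p hp K (fun k => (hc k).2) k₀
  exact ⟨k, hk, (hc k).1, hMI⟩

/-! ## §3 The reduction of F4-I(p,p) to chains with cofinally many Milnor-infinite states -/

/-- **`NoIsolatedTrap p p` ⟸ «no perfect field carries an infinite isolated `Step0 p` chain with Milnor-infinite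
states beyond every index».** [folklore] -/
theorem noIsolatedTrap_of_no_cofinal_milnorInfinite (p : ℕ) (hp : p.Prime)
    (h : ∀ (L : Type) [Field L] [CharP L p] [PerfectField L] [DecidableEq L],
      ¬ ∃ c : ℕ → State L, (∀ k, IsIsolated p (c k).F ∧ Step0 p (c k) (c (k + 1))) ∧
        ∀ k₀, ∃ k, k₀ ≤ k ∧ ¬ Module.Finite L (MvPowerSeries (Fin 4) L ⧸
          Ideal.span (Set.range fun t : Fin 4 =>
            MvPowerSeries.pderiv t (((c k).F : MvPolynomial (Fin 4) L) : MvPowerSeries (Fin 4) L)))) :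
    NoIsolatedTrap p p := by
  refine IsolatedChainBaseChange.noIsolatedTrap_of_forall_perfectField p p fun L _ _ _ _ => ?_
  rintro ⟨c, hc⟩
  exact h L ⟨c, hc, fun k₀ => exists_ge_not_milnorFinite p hp L (fun k => (hc k).2) k₀⟩

/-- **The reduction is an equivalence**: `NoIsolatedTrap p p` iff no perfect field of characteristic `p`
carries an infinite isolated `Step0 p` chain with cofinally many Milnor-infinite states. [folklore] -/
theorem noIsolatedTrap_iff_no_cofinal_milnorInfinite (p : ℕ) (hp : p.Prime) :
    NoIsolatedTrap p p ↔
      ∀ (L : Type) [Field L] [CharP L p] [PerfectField L] [DecidableEq L],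
        ¬ ∃ c : ℕ → State L, (∀ k, IsIsolated p (c k).F ∧ Step0 p (c k) (c (k + 1))) ∧
          ∀ k₀, ∃ k, k₀ ≤ k ∧ ¬ Module.Finite L (MvPowerSeries (Fin 4) L ⧸
            Ideal.span (Set.range fun t : Fin 4 =>
              MvPowerSeries.pderiv t (((c k).F : MvPolynomial (Fin 4) L) : MvPowerSeries (Fin 4) L))) := by
  refine ⟨fun h L _ _ _ _ => ?_, noIsolatedTrap_of_no_cofinal_milnorInfinite p hp⟩
  rintro ⟨c, hc, -⟩
  exact h L ⟨c, hc⟩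

/-- **F4-I(3,3) BEYOND MILNOR-FINITE — the desk's reduction (WORD #35 (b)).** `NoIsolatedTrap 3 3` follows
once no perfect field of characteristic `3` carries an infinite `Step0 3` chain of `J₃⁺`-ISOLATED states with
Milnor-INFINITE states beyond every index. [folklore] -/
theorem noIsolatedTrap_three_three_of
    (h : ∀ (L : Type) [Field L] [CharP L 3] [PerfectField L] [DecidableEq L],
      ¬ ∃ c : ℕ → State L, (∀ k, IsIsolated 3 (c k).F ∧ Step0 3 (c k) (c (k + 1))) ∧
        ∀ k₀, ∃ k, k₀ ≤ k ∧ ¬ Module.Finite L (MvPowerSeries (Fin 4) L ⧸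
          Ideal.span (Set.range fun t : Fin 4 =>
            MvPowerSeries.pderiv t (((c k).F : MvPolynomial (Fin 4) L) : MvPowerSeries (Fin 4) L)))) :
    NoIsolatedTrap 3 3 :=
  noIsolatedTrap_of_no_cofinal_milnorInfinite 3 Nat.prime_three h

/-! ## §4 The census face of «Milnor-finite»: a certificate on the GRADIENT ideal -/

/-- **Milnor-finite ⟺ a certificate for the gradient ideal**: `K⟦x⟧ ⧸ ⟨∂ᵢ↑F⟩` is finite over `K` iff
`𝔪₀ᴺ ≤ ⟨∂₁F, …, ∂₄F⟩ + 𝔪₀ᴺ⁺¹` in `K[x]` for some `N` (char-free; `⟨∂ᵢF⟩ = J₂⁺(F)` is bookkeeping,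
p-3's `IsolationCert.singLocusIdeal_two`). Engines: run PR-10's stabilisation instrument on the GRADIENT
ideal to decide Milnor-(in)finiteness. [folklore] -/
theorem milnorFinite_iff_exists_gradient_certificate (F : MvPolynomial (Fin 4) K) :
    Module.Finite K (MvPowerSeries (Fin 4) K ⧸ Ideal.span (Set.range fun t : Fin 4 =>
        MvPowerSeries.pderiv t ((F : MvPolynomial (Fin 4) K) : MvPowerSeries (Fin 4) K))) ↔
      ∃ N : ℕ, originIdeal K ^ N ≤
        Ideal.span (Set.range fun i : Fin 4 => pderiv i F) ⊔ originIdeal K ^ (N + 1) := by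
  constructor
  · intro hfin
    haveI := hfin
    obtain ⟨M, hM⟩ := Literature.RingTheory.MvPowerSeries.Jets.exists_maximalIdeal_pow_le_of_finite_quotient
      (Ideal.span (Set.range fun t : Fin 4 =>
        MvPowerSeries.pderiv t ((F : MvPolynomial (Fin 4) K) : MvPowerSeries (Fin 4) K)))
    refine ⟨M, IsolationCert.pow_le_sup_pow_succ_of_forall_monomial fun γ hγ => ?_⟩
    exact monomial_mem_span_pderiv_sup_of_maximalIdeal_pow_le hM hγ
  · rintro ⟨N, hN⟩
    rw [← IsolationCert.singLocusIdeal_two] at hN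
    have hle := WildConesBridge.maximalIdeal_pow_le_span_pderiv_of_certificate hN
    haveI := Literature.RingTheory.MvPowerSeries.Jets.finite_quotient_maximalIdeal_pow
      (σ := Fin 4) (K := K) N
    exact Module.Finite.of_surjective (Ideal.Quotient.factorₐ K hle).toLinearMap
      (Ideal.Quotient.factor_surjective hle)

end IsolatedBand

end Summit.ResolutionOfSingularities.ResolutionOfSingularities.Theorems.PIDim4

end
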